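import Summits.QuantumFields.BalabanUV.Beta.GAN24.E3UnitSplitLevels
import Summits.QuantumFields.BalabanUV.Beta.SymAveragingHessianCounts

/-!
# The Λ statements of `E3UnitSplitLevels` that name `lagrInc` ∕ `hessFF`, RE-RUN WITH THE SYMMETRISED Lagrange increment over an1's SYM table `symHessFFAt ρ Lc`
# (the block lemmas and the three Λ unit-split templates), for EVERY root `ρ` — package (ρ-b) of the W5 «ROOTED-S3-Λ» chain at the sym table

NOT IN PRINT — OUR BOOKKEEPING (road-P2 = `b2b-balaban-gan24-p2` gen 56, 2026-08-25; row G-an2-4 ∕ (CONV-C), the (α-0) chain at row D1's literal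
OF RECORD (III′) `JsB12CombShSym`; [folklore] composition BY NAME; ONE bookkeeping `def` ([our object] `symLagrIncAt` — the sym twin of asym's `SpineRooted.lagrIncAt`,
asserting nothing), 0 cite, 0 `def … : Prop`, 0 `sorry`).  Weight 0.  NEVER «G-an2-4 closed» as (CONV-C); NOT D1, NOT BetaPertH, NOT continuum, NOT Clay; NO campaign
opened (an2 W-4) — typed while idle under R-2 as the SECOND BRICK of the located `hUg-Λ` transfer (road-P2 MEMO M-gan24p2-g56-1, `gen56/S-CAMPAIGN-SIZING-g56.v0_4.md` §2(a)).

METHOD = the OWNER gan24-p1's gen-6 `mkroot.py` rule applied to leaf-01 g60's (ρ-b) `E3UnitSplitLevelsAt`: same theorem shapes with `lagrIncAt d ρ Lc ↦ symLagrIncAt d ρ Lc`,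
`hessFFAt ρ Lc ↦ symHessFFAt ρ Lc`, an1's sym block lemmas `symHessFFAt_inl_inr ∕ symHessFFAt_inr`; every root-free base lemma (`SLam_block_zero`, `avgLift_block_zero`,
`e3FF_unit_split_of`) BY NAME from `E3UnitSplit(Levels)`; base and rooted modules untouched.  No box hypothesis is needed at this level (exponent algebra over the root-free
`e3FF_unit_split_of`); it enters in (ρ-a)-sym `TaylorMassLamSymAt` (M.65) and the later rows through an1's support ∕ `biLoc` lemmas.
* §0 [our object] **`symLagrIncAt d ρ Lc M N′ κ u := SLam N′ (lamCoeffOf (KInv N′) N′) (fun μ y ↦ avgLift M (symHessFFAt ρ Lc μ y)) κ u`** — THE SYMMETRISED LAGRANGE INCREMENT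
  (asym's `lagrIncAt` with `hessFFAt ↦ symHessFFAt`: at the passage from the `M`-fold to the `N′ = M·Lc`-fold composite, the Λ-piece at blocking `N′` of an1's sym Hessian table lifted
  to the fine legs by `avgLift M`); `symLagrIncAt_apply` (`rfl`).
* §1 blocks: **`symLagrIncAt_inl_inr`**, **`symLagrIncAt_inr`**, **`SLam0SymAt_inl_inr`**, **`SLam0SymAt_inr`** (`S₀`'s sym Lagrange stencil `SLam Lc (lamCoeffOf (KInv Lc) Lc) (symHessFFAt ρ Lc)`).
* §2 Λ templates: **`e3Lam_unit_split`** (`F = symLagrIncAt d ρ Lc (Lc^ℓ) (Lc^{ℓ+1})`), **`e3LamTop_unit_split`** (`k = 0`), **`e3Lam0_unit_split`** (`ℓ = 0`) — VERBATIM the base ∕ rooted shapes.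
USE (located): the sym twins of (ρ-c) `TaylorRowLamAt` ∕ (ρ-d) `TaylorRowLamTopAt`, `S3ShapeL0At` consume these; then `BornLambdaLift ∕ UndressedRow ∕ RowHolds` at the sym table —
the `hUg-Λ` letter of road-P2's M.60 `CombBornLambdaSocket`.  Discharges NOTHING; NO estimate.
-/

noncomputable section

open Finset
open scoped BigOperators
open Literature.MathematicalPhysics.QuantumFieldTheory
open Literature.MathematicalPhysics.QuantumFieldTheory.Balaban1983to89
open Literature.MathematicalPhysics.QuantumFieldTheory.Balaban1983to89.Beta
open ExpKernelCalculus (MKer comp)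
open KernelSpecInstance (wH wΦ)
open KKTFluctuationKernel (Gam GamΦ)
open OneStepResolventKernel (Fib LocStencil KInv wsum vertexOf)
open InterLevelTransport (SLam avgLift)
open BalabanStepJets (lamCoeffOf)
open Summit.QuantumFields.BalabanUV.Beta.SymAveragingHessianCounts (symHessFFAt symHessFFAt_inl_inr symHessFFAt_inr)
open Summit.QuantumFields.BalabanUV.Beta.GAN24.E3UnitSplit (e3OfS SLam_block_zero avgLift_block_zero e3FF_unit_split_of)

namespace Summit.QuantumFields.BalabanUV.Beta.GAN24.E3UnitSplitLevelsSymAt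

variable {d : ℕ}

/-! ## §0 The symmetrised Lagrange increment -/

section Def

variable (d)

/-- [our object] **THE SYMMETRISED LAGRANGE INCREMENT** (sym twin of asym's `SpineRooted.lagrIncAt`, which has an1's ROOTED `hessFFAt ρ` inside): at the passage from the
`M`-fold to the `N′`-fold composite (`N′ = M·Lc` in use), the Λ-piece at blocking `N′` — multiplier response `lamCoeffOf (KInv N′) N′`, root-free — of an1's SYMMETRISED
field–field constraint Hessian table `symHessFFAt ρ Lc`, pulled back to the fine legs by `avgLift M`. -/
def symLagrIncAt (ρ : Fin (d + 1) → ℤ) (Lc M N' : ℕ) [NeZero N'] (κ : Fin (d + 1)) (u : Fin (d + 1) → ℤ) : MKer (d + 1) (Fib d) :=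
  SLam N' (lamCoeffOf (KInv (N := N') (d := d)) N') (fun μ y => avgLift M (symHessFFAt ρ Lc μ y)) κ u

variable {d}

/-- [folklore] `symLagrIncAt` unfolded (`rfl`). -/
theorem symLagrIncAt_apply (ρ : Fin (d + 1) → ℤ) (Lc M N' : ℕ) [NeZero N'] (κ : Fin (d + 1)) (u : Fin (d + 1) → ℤ) :
    symLagrIncAt d ρ Lc M N' κ u = SLam N' (lamCoeffOf (KInv (N := N') (d := d)) N') (fun μ y => avgLift M (symHessFFAt ρ Lc μ y)) κ u := rfl

end Def

/-! ## §1 Block supports of the symmetrised Λ increments -/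

section Blocks

/-- [folklore] **THE SYMMETRISED LAGRANGE INCREMENT IS FIELD–FIELD-SUPPORTED** (an1's `symHessFFAt ρ` is): no (inl, inr) block. -/
theorem symLagrIncAt_inl_inr (ρ : Fin (d + 1) → ℤ) {Lc M N' : ℕ} [NeZero N'] (κ : Fin (d + 1)) (u x z : Fin (d + 1) → ℤ) (α ν : Fin (d + 1)) :
    symLagrIncAt d ρ Lc M N' κ u x z (Sum.inl α) (Sum.inr ν) = 0 :=
  SLam_block_zero _ _ _ _ (fun μ y x z => avgLift_block_zero _ _ _ (fun x z => symHessFFAt_inl_inr ρ Lc μ y x z α ν) x z) κ u x z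

/-- [folklore] The symmetrised Lagrange increment has no multiplier rows. -/
theorem symLagrIncAt_inr (ρ : Fin (d + 1) → ℤ) {Lc M N' : ℕ} [NeZero N'] (κ : Fin (d + 1)) (u x z : Fin (d + 1) → ℤ) (μ : Fin (d + 1)) (b : Fib d) :
    symLagrIncAt d ρ Lc M N' κ u x z (Sum.inr μ) b = 0 :=
  SLam_block_zero _ _ _ _ (fun μ' y x z => avgLift_block_zero _ _ _ (fun x z => symHessFFAt_inr ρ Lc μ' y x z μ b) x z) κ u x z

/-- [folklore] `S₀`'s SYMMETRISED Lagrange stencil has no (inl, inr) block. -/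
theorem SLam0SymAt_inl_inr (ρ : Fin (d + 1) → ℤ) {Lc : ℕ} [NeZero Lc] (κ : Fin (d + 1)) (u x z : Fin (d + 1) → ℤ) (α ν : Fin (d + 1)) :
    SLam Lc (lamCoeffOf (KInv (N := Lc) (d := d)) Lc) (fun μ y => symHessFFAt ρ Lc μ y) κ u x z (Sum.inl α) (Sum.inr ν) = 0 :=
  SLam_block_zero _ _ _ _ (fun μ y x z => symHessFFAt_inl_inr ρ Lc μ y x z α ν) κ u x z

/-- [folklore] `S₀`'s SYMMETRISED Lagrange stencil has no multiplier rows. -/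
theorem SLam0SymAt_inr (ρ : Fin (d + 1) → ℤ) {Lc : ℕ} [NeZero Lc] (κ : Fin (d + 1)) (u x z : Fin (d + 1) → ℤ) (μ : Fin (d + 1)) (b : Fib d) :
    SLam Lc (lamCoeffOf (KInv (N := Lc) (d := d)) Lc) (fun μ y => symHessFFAt ρ Lc μ y) κ u x z (Sum.inr μ) b = 0 :=
  SLam_block_zero _ _ _ _ (fun μ' y x z => symHessFFAt_inr ρ Lc μ' y x z μ b) κ u x z

end Blocks

/-! ## §2 The Λ templates per level with the symmetrised increment (residual power displayed, as in the base module) -/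

section Levels

variable {Lc : ℕ} [NeZero Lc]

/-- [folklore] **THE (Λ) TEMPLATE, LEVEL `ℓ ≥ 1`, SYMMETRISED** (every root `ρ`): `F = symLagrIncAt d ρ Lc (Lc^ℓ) (Lc^{ℓ+1})` in the root-free `e3FF_unit_split_of`. -/
theorem e3Lam_unit_split (ρ : Fin (d + 1) → ℤ) (cΛ : ℝ) (ℓ k p : ℕ) (hp : p = ℓ + k + 1) (κ' : Fin (d + 1)) (u' x' z' : Fin (d + 1) → ℤ) (α β : Fin (d + 1)) :
    ((Lc : ℝ) ^ p) ^ (2 * (d + 1)) *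
        e3OfS (Lc ^ p) (fun κ u => (((Lc : ℝ) ^ (d + 1)) ^ k * (cΛ * ((Lc : ℝ) ^ ℓ) ^ (2 * d + 4))) • symLagrIncAt d ρ Lc (Lc ^ ℓ) (Lc ^ (ℓ + 1)) κ u)
          κ' u' x' z' (Sum.inl α) (Sum.inl β) =
      -(cΛ / (Lc : ℝ) ^ (d + 1)) * ((Lc : ℝ) ^ p) ^ ((d : ℤ) - 2) * ((Lc : ℝ) ^ ℓ) ^ (d + 3) *
        ∑' y : Fin (d + 1) → ℤ, ∑ l' : Fin (d + 1),
          (∑' w : Fin (d + 1) → ℤ, ∑ l : Fin (d + 1), (((Lc : ℝ) ^ p) ^ (d + 2) * GamΦ (N := Lc ^ p) α x' l w) *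
              ∑ κ'' : Fin (d + 1), (((Lc : ℝ) ^ p) ^ (d + 1))⁻¹ * ∑' u : Fin (d + 1) → ℤ,
                (((Lc : ℝ) ^ p) ^ (d + 2) * wH (N := Lc ^ p) κ'' κ' (u - ((Lc ^ p : ℕ) : ℤ) • u')) *
                  symLagrIncAt d ρ Lc (Lc ^ ℓ) (Lc ^ (ℓ + 1)) κ'' u w y (Sum.inl l) (Sum.inl l')) *
            (((Lc : ℝ) ^ p) ^ (d + 2) * wH (N := Lc ^ p) l' β (y - ((Lc ^ p : ℕ) : ℤ) • z')) :=
  e3FF_unit_split_of (Lc := Lc) (fun κ u => symLagrIncAt d ρ Lc (Lc ^ ℓ) (Lc ^ (ℓ + 1)) κ u) (fun κ u x z α ν => symLagrIncAt_inl_inr ρ κ u x z α ν)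
    (fun κ u x z μ b => symLagrIncAt_inr ρ κ u x z μ b) cΛ ℓ k p hp κ' u' x' z' α β

/-- [folklore] **THE (Λ) TEMPLATE, TOP LEVEL, SYMMETRISED** (`k = 0`, member `p = ℓ+1`, natural weight `cΛ·M^{2d+4}`). -/
theorem e3LamTop_unit_split (ρ : Fin (d + 1) → ℤ) (cΛ : ℝ) (ℓ p : ℕ) (hp : p = ℓ + 1) (κ' : Fin (d + 1)) (u' x' z' : Fin (d + 1) → ℤ) (α β : Fin (d + 1)) :
    ((Lc : ℝ) ^ p) ^ (2 * (d + 1)) *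
        e3OfS (Lc ^ p) (fun κ u => (cΛ * ((Lc : ℝ) ^ ℓ) ^ (2 * d + 4)) • symLagrIncAt d ρ Lc (Lc ^ ℓ) (Lc ^ (ℓ + 1)) κ u) κ' u' x' z' (Sum.inl α) (Sum.inl β) =
      -(cΛ / (Lc : ℝ) ^ (d + 1)) * ((Lc : ℝ) ^ p) ^ ((d : ℤ) - 2) * ((Lc : ℝ) ^ ℓ) ^ (d + 3) *
        ∑' y : Fin (d + 1) → ℤ, ∑ l' : Fin (d + 1),
          (∑' w : Fin (d + 1) → ℤ, ∑ l : Fin (d + 1), (((Lc : ℝ) ^ p) ^ (d + 2) * GamΦ (N := Lc ^ p) α x' l w) *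
              ∑ κ'' : Fin (d + 1), (((Lc : ℝ) ^ p) ^ (d + 1))⁻¹ * ∑' u : Fin (d + 1) → ℤ,
                (((Lc : ℝ) ^ p) ^ (d + 2) * wH (N := Lc ^ p) κ'' κ' (u - ((Lc ^ p : ℕ) : ℤ) • u')) *
                  symLagrIncAt d ρ Lc (Lc ^ ℓ) (Lc ^ (ℓ + 1)) κ'' u w y (Sum.inl l) (Sum.inl l')) *
            (((Lc : ℝ) ^ p) ^ (d + 2) * wH (N := Lc ^ p) l' β (y - ((Lc ^ p : ℕ) : ℤ) • z')) := by
  simpa only [pow_zero, one_mul] using e3Lam_unit_split (Lc := Lc) (d := d) ρ cΛ ℓ 0 p (by simpa using hp) κ' u' x' z' α β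

/-- [folklore] **THE (Λ) TEMPLATE, LEVEL `0`, SYMMETRISED** (`S₀`'s sym Lagrange stencil, natural weight `(Lc^{d+1})^k·cΛ`, member `p = k+1`; `M^{d+3} = 1`). -/
theorem e3Lam0_unit_split (ρ : Fin (d + 1) → ℤ) (cΛ : ℝ) (k p : ℕ) (hp : p = k + 1) (κ' : Fin (d + 1)) (u' x' z' : Fin (d + 1) → ℤ) (α β : Fin (d + 1)) :
    ((Lc : ℝ) ^ p) ^ (2 * (d + 1)) *
        e3OfS (Lc ^ p) (fun κ u => (((Lc : ℝ) ^ (d + 1)) ^ k * cΛ) •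
          SLam Lc (lamCoeffOf (KInv (N := Lc) (d := d)) Lc) (fun μ y => symHessFFAt ρ Lc μ y) κ u) κ' u' x' z' (Sum.inl α) (Sum.inl β) =
      -(cΛ / (Lc : ℝ) ^ (d + 1)) * ((Lc : ℝ) ^ p) ^ ((d : ℤ) - 2) *
        ∑' y : Fin (d + 1) → ℤ, ∑ l' : Fin (d + 1),
          (∑' w : Fin (d + 1) → ℤ, ∑ l : Fin (d + 1), (((Lc : ℝ) ^ p) ^ (d + 2) * GamΦ (N := Lc ^ p) α x' l w) *
              ∑ κ'' : Fin (d + 1), (((Lc : ℝ) ^ p) ^ (d + 1))⁻¹ * ∑' u : Fin (d + 1) → ℤ,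
                (((Lc : ℝ) ^ p) ^ (d + 2) * wH (N := Lc ^ p) κ'' κ' (u - ((Lc ^ p : ℕ) : ℤ) • u')) *
                  SLam Lc (lamCoeffOf (KInv (N := Lc) (d := d)) Lc) (fun μ y => symHessFFAt ρ Lc μ y) κ'' u w y (Sum.inl l) (Sum.inl l')) *
            (((Lc : ℝ) ^ p) ^ (d + 2) * wH (N := Lc ^ p) l' β (y - ((Lc ^ p : ℕ) : ℤ) • z')) := by
  simpa only [pow_zero, one_pow, mul_one] using
    e3FF_unit_split_of (Lc := Lc) (fun κ u => SLam Lc (lamCoeffOf (KInv (N := Lc) (d := d)) Lc) (fun μ y => symHessFFAt ρ Lc μ y) κ u)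
      (fun κ u x z α ν => SLam0SymAt_inl_inr ρ κ u x z α ν) (fun κ u x z μ b => SLam0SymAt_inr ρ κ u x z μ b) cΛ 0 k p (by simpa using hp)
      κ' u' x' z' α β

end Levels

end Summit.QuantumFields.BalabanUV.Beta.GAN24.E3UnitSplitLevelsSymAt

end
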